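import Summits.CriticalPhenomena.PercolationContinuityZ3.Theorems.FK.TranslationAveragesFK
import Summits.CriticalPhenomena.PercolationContinuityZ3.Theorems.FK.LatticeEdgeCounting
import HarnessLib

/-!
# FK-continuity cell, FO-10a: the density of open edges of the box concentrates at the edge density —
# `|ω ∩ E_{Λ_n}| / |Λ_n| → d · h^b(p,q)` in `L¹(φ^b_{p,q})` and in `φ^b_{p,q}`-probability

Registered R111 (cell INBOX l.7597, 2026-08-25); registry row FO-10a-g342; label LLN-E (coordinator fk-4 g228).
Cell `fk-continuity` (bschramm), row FO-10a (pressure layer); support file for the FK-continuity transplant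
(`--supports stmt-CriticalPhenomena-4575`); builds on p205010 (kernel theorem, internal audit signed; external expert
review pending). Pure proofs; no definitions, no named facts, no sorries; `0 ≤ p ≤ 1`, `q ≥ 1`, both boundary
conditions `b`, `d ≥ 1`. UNCONDITIONAL infinite-volume structure; it decides nothing about FH / TP_FK / the value of
`p_c(q)` or of `h^b` there.

Grimmett 2006, (4.61) and the proof of Thm. (4.63), (4.74)–(4.76): `h^b(p,q) = φ^b_{p,q}(e open)` does not depend on the
edge `e`, and the MEAN number of open edges of `E_Λ` per site tends to `d h^b` (tree: `PressureEdgeDensity.lean`,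
`BoundaryWiringEdgeDensity.lean`, for the finite-volume laws). Under the infinite-volume measure `φ^b_{p,q}` the random
variable itself concentrates: the number of open edges of `E_{Λ_n}` is squeezed between the numbers of open COORDINATE
edges `⟨x, x + e_i⟩`, `x ∈ Λ_{n−1}` resp. `x ∈ Λ_n` (`LatticeEdgeCounting.lean`), and for each direction `i` the open
coordinate edges are the occurrences of the translates of the local event `{⟨0, e_i⟩ open}`, whose density obeys the law
of large numbers of `TranslationAveragesFK.lean`:

* `mem_preimage_relabel_shift_neg_setOf_mem_iff` — `ω − x ∈ {⟨0,e_i⟩ open} ↔ ⟨x, x+e_i⟩ ∈ ω`;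
* `rcLimit_real_setOf_mem_eq_of_mem_edgeSet` — `φ^b_{p,q}(e open) = φ^b_{p,q}(e' open)` for lattice edges `e, e'`;
* `card_filter_coordEdge_box_pred_le`, `card_filter_edgesIn_le_card_filter_coordEdge` — the squeeze
  `S(ω,Λ_{n−1}) ≤ |ω ∩ E_{Λ_n}| ≤ S(ω,Λ_n)`, `S(ω,Λ) = #{(x,i) ∈ Λ × [d] : ⟨x,x+e_i⟩ ∈ ω}`;
* **`tendsto_integral_abs_openEdges_div_card_box_sub`** — `∫ | |ω ∩ E_{Λ_n}|/|Λ_n| − d φ^b(e₀ open) | dφ^b_{p,q} → 0`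
  (`d ≥ 1`, any lattice edge `e₀`), and **`tendsto_rcLimit_real_le_abs_openEdges_div_card_box_sub`** (in probability).

## References

* G. Grimmett, *The Random-Cluster Model*, Springer 2006 (`book:grimmett2006-random-cluster-model`): §4.3 Cor. (4.23)
  [PDF p. 79]; (4.61) and the proof of Thm. (4.63), (4.74)–(4.76) [PDF pp. 86–88]. [Grimmett2006]
-/

noncomputable section

open MeasureTheory Set Filter Finset
open scoped Topology ENNReal

namespace Summit.CriticalPhenomena.PercolationContinuityZ3.Theorems.FK

open Literature.Probability.Percolation Literature.Probability.LatticeModels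

variable {d : ℕ} {p q : ℝ}

/-! ### Open coordinate edges as occurrences of translated one-edge events -/

/-- **`ω − x ∈ {⟨0, e_i⟩ open} ↔ ⟨x, x + e_i⟩ ∈ ω`.** [cite: Grimmett2006, §4.3 (translations τ_x)] -/
theorem mem_preimage_relabel_shift_neg_setOf_mem_iff (x : Site d) (i : Fin d) (ω : BondConfig (Site d)) :
    ω ∈ BondConfig.relabel (sym2Equiv (Site.shift (-x))) ⁻¹' {ω : BondConfig (Site d) | s((0 : Site d), Pi.single i 1) ∈ ω}
      ↔ s(x, x + Pi.single i 1) ∈ ω := by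
  rw [Set.mem_preimage, Set.mem_setOf_eq, BondConfig.mem_relabel_iff, sym2Equiv_shift_symm, neg_neg, sym2Equiv_apply,
    Sym2.map_mk, Site.shift_apply, Site.shift_apply, zero_add, add_comm (Pi.single i 1) x]

open Classical in
/-- The direction-summed indicator of the translated one-edge events counts the open coordinate edges based in `Λ`:
`Σ_{x∈Λ} Σ_i 1{ω − x ∈ {⟨0,e_i⟩ open}} = #{(x,i) ∈ Λ × [d] : ⟨x, x+e_i⟩ ∈ ω}`. [folklore] -/
theorem sum_sum_indicator_eq_card_filter_coordEdge (Λ : Finset (Site d)) (ω : BondConfig (Site d)) :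
    ∑ x ∈ Λ, ∑ i : Fin d, (BondConfig.relabel (sym2Equiv (Site.shift (-x))) ⁻¹'
        {ω : BondConfig (Site d) | s((0 : Site d), Pi.single i 1) ∈ ω}).indicator (1 : BondConfig (Site d) → ℝ) ω =
      #((Λ ×ˢ (Finset.univ : Finset (Fin d))).filter fun xi => s(xi.1, xi.1 + Pi.single xi.2 1) ∈ ω) := by
  rw [← Finset.sum_product (f := fun xi : Site d × Fin d => (BondConfig.relabel (sym2Equiv (Site.shift (-xi.1))) ⁻¹'
    {ω : BondConfig (Site d) | s((0 : Site d), Pi.single xi.2 1) ∈ ω}).indicator (1 : BondConfig (Site d) → ℝ) ω),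
    ← Finset.sum_boole]
  refine Finset.sum_congr rfl fun xi _ => ?_
  by_cases h : s(xi.1, xi.1 + Pi.single xi.2 1) ∈ ω
  · rw [if_pos h, Set.indicator_of_mem ((mem_preimage_relabel_shift_neg_setOf_mem_iff xi.1 xi.2 ω).2 h), Pi.one_apply]
  · rw [if_neg h, Set.indicator_of_notMem (fun h' => h ((mem_preimage_relabel_shift_neg_setOf_mem_iff xi.1 xi.2 ω).1 h'))]

open Classical in
/-- **Upper squeeze**: every open edge of `E_Λ` is an open coordinate edge based in `Λ`, so
`|ω ∩ E_Λ| ≤ #{(x,i) ∈ Λ × [d] : ⟨x, x+e_i⟩ ∈ ω}`. [cite: Grimmett2006, proof of Thm. (4.63), (4.75)] -/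
theorem card_filter_edgesIn_le_card_filter_coordEdge (Λ : Finset (Site d)) (ω : BondConfig (Site d)) :
    #((edgesIn (zdGraph d) Λ).filter fun e => e ∈ ω) ≤
      #((Λ ×ˢ (Finset.univ : Finset (Fin d))).filter fun xi => s(xi.1, xi.1 + Pi.single xi.2 1) ∈ ω) := by
  calc #((edgesIn (zdGraph d) Λ).filter fun e => e ∈ ω)
      ≤ #(((Λ ×ˢ (Finset.univ : Finset (Fin d))).filter fun xi => s(xi.1, xi.1 + Pi.single xi.2 1) ∈ ω).image
          fun xi => s(xi.1, xi.1 + Pi.single xi.2 1)) := by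
        refine Finset.card_le_card fun e he => ?_
        rw [Finset.mem_filter] at he
        obtain ⟨xi, hxi, rfl⟩ := Finset.mem_image.1 (edgesIn_subset_image_coordEdge Λ he.1)
        exact Finset.mem_image.2 ⟨xi, Finset.mem_filter.2 ⟨hxi, he.2⟩, rfl⟩
    _ ≤ _ := Finset.card_image_le

open Classical in
/-- **Lower squeeze**: the open coordinate edges based in `Λ_{N−1}` are distinct open edges of `E_{Λ_N}` (`N ≥ 1`), so
`#{(x,i) ∈ Λ_{N−1} × [d] : ⟨x, x+e_i⟩ ∈ ω} ≤ |ω ∩ E_{Λ_N}|`. [cite: Grimmett2006, proof of Thm. (4.63), (4.75)] -/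
theorem card_filter_coordEdge_box_pred_le {N : ℕ} (hN : 1 ≤ N) (ω : BondConfig (Site d)) :
    #((box d (N - 1) ×ˢ (Finset.univ : Finset (Fin d))).filter fun xi => s(xi.1, xi.1 + Pi.single xi.2 1) ∈ ω) ≤
      #((edgesIn (zdGraph d) (box d N)).filter fun e => e ∈ ω) := by
  have h := Finset.card_le_card (show
      ((box d (N - 1) ×ˢ (Finset.univ : Finset (Fin d))).filter fun xi => s(xi.1, xi.1 + Pi.single xi.2 1) ∈ ω).image
        (fun xi : Site d × Fin d => s(xi.1, xi.1 + Pi.single xi.2 1)) ⊆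
      (edgesIn (zdGraph d) (box d N)).filter fun e => e ∈ ω from ?_)
  · rwa [Finset.card_image_of_injective _ coordEdge_injective] at h
  · intro e he
    rw [Finset.mem_image] at he
    obtain ⟨⟨x, i⟩, hxi, rfl⟩ := he
    rw [Finset.mem_filter] at hxi ⊢
    exact ⟨coordEdge_mem_edgesIn_box (m := 1) le_rfl hN (Finset.mem_product.1 hxi.1).1 i, hxi.2⟩

/-! ### The edge density is the same for all lattice edges -/

/-- **`φ^b_{p,q}(e open) = φ^b_{p,q}(e' open)`** for lattice edges `e, e'` (`0 ≤ p ≤ 1`, `q ≥ 1`; Grimmett's `h^b(p,q)`).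
[cite: Grimmett2006, (4.61) ("h^b(p,q) does not depend on the choice of e")] -/
theorem rcLimit_real_setOf_mem_eq_of_mem_edgeSet (b : Bool) (hp : p ∈ Set.Icc (0 : ℝ) 1) (hq : 1 ≤ q)
    {e e' : Sym2 (Site d)} (he : e ∈ (zdGraph d).edgeSet) (he' : e' ∈ (zdGraph d).edgeSet) :
    (rcLimit d b p q).real {ω | e ∈ ω} = (rcLimit d b p q).real {ω | e' ∈ ω} := by
  obtain ⟨i, -, -⟩ := exists_eq_map_add_of_mem_edgeSet he
  have hd : 0 < d := Fin.pos i
  cases b with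
  | false =>
    rw [(isBoxLimit_rcLimit false hp hq).real_setOf_mem_eq_freeEdgeDensity hp hq,
      (isBoxLimit_rcLimit false hp hq).real_setOf_mem_eq_freeEdgeDensity hp hq, freeEdgeDensity_eq_of_mem_edgeSet hp hq he he']
  | true =>
    rw [(isBoxLimit_rcLimit true hp hq).real_setOf_mem_eq_wiredEdgeDensity hd hp hq,
      (isBoxLimit_rcLimit true hp hq).real_setOf_mem_eq_wiredEdgeDensity hd hp hq,
      wiredEdgeDensity_eq_of_mem_edgeSet hd hp hq he he']

/-! ### The law of large numbers for the open-edge density -/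

open Classical in
/-- **The direction-summed one-edge densities converge in `L¹`**: for finite `Λ_j ⊆ ℤ^d` with `|Λ_j| → ∞`,
`∫ | |Λ_j|⁻¹ #{(x,i) ∈ Λ_j × [d] : ⟨x,x+e_i⟩ ∈ ω} − d φ^b(e₀ open) | dφ^b_{p,q} → 0` (any lattice edge `e₀`).
[cite: Grimmett2006, Cor. (4.23) with (4.61)] -/
theorem tendsto_integral_abs_card_filter_coordEdge_div_sub (b : Bool) (hp : p ∈ Set.Icc (0 : ℝ) 1) (hq : 1 ≤ q)
    {e₀ : Sym2 (Site d)} (he₀ : e₀ ∈ (zdGraph d).edgeSet)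
    {ι : Type*} {l : Filter ι} {Λ : ι → Finset (Site d)} (hΛ : Tendsto (fun j => (#(Λ j) : ℝ)) l atTop) :
    Tendsto (fun j => ∫ ω, |(#(Λ j) : ℝ)⁻¹ *
        #((Λ j ×ˢ (Finset.univ : Finset (Fin d))).filter fun xi => s(xi.1, xi.1 + Pi.single xi.2 1) ∈ ω) -
        d * (rcLimit d b p q).real {ω | e₀ ∈ ω}| ∂(rcLimit d b p q)) l (𝓝 0) := by
  haveI := isProbabilityMeasure_rcLimit (d := d) b p q
  set P := rcLimit d b p q with hP
  set A : Fin d → Set (BondConfig (Site d)) := fun i => {ω | s((0 : Site d), Pi.single i 1) ∈ ω} with hA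
  have hAloc : ∀ i, IsLocalEvent (A i) := fun i => isLocalEvent_setOf_mem _
  have hAm : ∀ i, MeasurableSet (A i) := fun i => measurableSet_of_isLocalEvent_holds (hAloc i)
  have hAi : ∀ i, P.real (A i) = P.real {ω | e₀ ∈ ω} := fun i =>
    rcLimit_real_setOf_mem_eq_of_mem_edgeSet b hp hq (coordEdge_zero_mem_edgeSet i) he₀
  -- per direction: the `L¹` law of large numbers for the local event `A i`
  have hone : ∀ i, Tendsto (fun j => ∫ ω, |(#(Λ j) : ℝ)⁻¹ *
      ∑ x ∈ Λ j, (BondConfig.relabel (sym2Equiv (Site.shift (-x))) ⁻¹' A i).indicator (1 : BondConfig (Site d) → ℝ) ω -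
      P.real (A i)| ∂P) l (𝓝 0) := fun i => tendsto_integral_abs_density_sub_rcLimit b hp hq (hAloc i) hΛ
  have hsum : Tendsto (fun j => ∑ i : Fin d, ∫ ω, |(#(Λ j) : ℝ)⁻¹ *
      ∑ x ∈ Λ j, (BondConfig.relabel (sym2Equiv (Site.shift (-x))) ⁻¹' A i).indicator (1 : BondConfig (Site d) → ℝ) ω -
      P.real (A i)| ∂P) l (𝓝 0) := by
    have h := tendsto_finsetSum (Finset.univ : Finset (Fin d)) fun i _ => hone i
    simpa using h
  refine squeeze_zero (fun j => integral_nonneg fun ω => abs_nonneg _) (fun j => ?_) hsum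
  -- pointwise: the direction sum of the per-direction deviations dominates the total deviation
  have hint : ∀ i, Integrable (fun ω => (#(Λ j) : ℝ)⁻¹ *
      ∑ x ∈ Λ j, (BondConfig.relabel (sym2Equiv (Site.shift (-x))) ⁻¹' A i).indicator (1 : BondConfig (Site d) → ℝ) ω -
      P.real (A i)) P := fun i =>
    ((integrable_finsetSum _ fun x _ => ((integrable_const (1 : ℝ)).indicator
      ((BondConfig.relabel _).measurable (hAm i)))).const_mul _).sub (integrable_const _)
  rw [← integral_finsetSum _ fun i _ => (hint i).abs]
  refine integral_mono_of_nonneg (Eventually.of_forall fun ω => abs_nonneg _)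
    (integrable_finsetSum _ fun i _ => (hint i).abs) (Eventually.of_forall fun ω => ?_)
  have heq : (#(Λ j) : ℝ)⁻¹ *
      #((Λ j ×ˢ (Finset.univ : Finset (Fin d))).filter fun xi => s(xi.1, xi.1 + Pi.single xi.2 1) ∈ ω) -
      d * P.real {ω | e₀ ∈ ω} =
      ∑ i : Fin d, ((#(Λ j) : ℝ)⁻¹ *
        ∑ x ∈ Λ j, (BondConfig.relabel (sym2Equiv (Site.shift (-x))) ⁻¹' A i).indicator (1 : BondConfig (Site d) → ℝ) ω -
        P.real (A i)) := by
    rw [Finset.sum_sub_distrib, ← Finset.mul_sum, Finset.sum_comm, sum_sum_indicator_eq_card_filter_coordEdge]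
    simp_rw [hAi]
    rw [Finset.sum_const, Finset.card_univ, Fintype.card_fin, nsmul_eq_mul]
  dsimp only
  rw [heq]
  exact Finset.abs_sum_le_sum_abs _ _

/-! ### Two elementary real inequalities for the squeeze -/

/-- If `lo ≤ x ≤ hi` then `|x − c| ≤ |hi − c| + |lo − c|`. [folklore] -/
theorem abs_sub_le_abs_add_abs_of_le_of_le {x lo hi c : ℝ} (hlo : lo ≤ x) (hhi : x ≤ hi) :
    |x - c| ≤ |hi - c| + |lo - c| := by
  rw [abs_le]
  constructor
  · linarith [neg_abs_le (lo - c), abs_nonneg (hi - c)]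
  · linarith [le_abs_self (hi - c), abs_nonneg (lo - c)]

/-- For `0 ≤ r ≤ 1` and `c ≥ 0`: `|r s − c| ≤ |s − c| + (1 − r) c`. [folklore] -/
theorem abs_mul_sub_le_of_le_one {r s c : ℝ} (hr0 : 0 ≤ r) (hr1 : r ≤ 1) (hc : 0 ≤ c) :
    |r * s - c| ≤ |s - c| + (1 - r) * c := by
  have h : r * s - c = r * (s - c) - (1 - r) * c := by ring
  rw [h]
  calc |r * (s - c) - (1 - r) * c| ≤ |r * (s - c)| + |(1 - r) * c| := abs_sub _ _
    _ = r * |s - c| + (1 - r) * c := by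
        rw [abs_mul, abs_of_nonneg hr0, abs_of_nonneg (mul_nonneg (sub_nonneg.2 hr1) hc)]
    _ ≤ |s - c| + (1 - r) * c := by nlinarith [abs_nonneg (s - c)]

open Classical in
/-- The number of open edges of a finite edge set is a sum of one-edge indicators (hence measurable and bounded).
[folklore] -/
theorem natCast_card_filter_mem_eq_sum_indicator (E : Finset (Sym2 (Site d))) (ω : BondConfig (Site d)) :
    (#(E.filter fun e => e ∈ ω) : ℝ) = ∑ e ∈ E, ({ω' : BondConfig (Site d) | e ∈ ω'}).indicator (1 : BondConfig (Site d) → ℝ) ω := by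
  rw [← Finset.sum_boole]
  refine Finset.sum_congr rfl fun e _ => ?_
  by_cases h : e ∈ ω
  · rw [if_pos h, Set.indicator_of_mem (show ω ∈ {ω' : BondConfig (Site d) | e ∈ ω'} from h), Pi.one_apply]
  · rw [if_neg h, Set.indicator_of_notMem (show ω ∉ {ω' : BondConfig (Site d) | e ∈ ω'} from h)]

open Classical in
/-- The open-edge count of a finite edge set, normalised and centred, is integrable. [folklore] -/
theorem integrable_card_filter_mem (E : Finset (Sym2 (Site d))) (a c : ℝ) (P : Measure (BondConfig (Site d)))
    [IsFiniteMeasure P] : Integrable (fun ω => a * (#(E.filter fun e => e ∈ ω) : ℝ) - c) P := by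
  have h : Integrable (fun ω => ∑ e ∈ E, ({ω' : BondConfig (Site d) | e ∈ ω'}).indicator
      (1 : BondConfig (Site d) → ℝ) ω) P :=
    integrable_finsetSum _ fun e _ => (integrable_const (1 : ℝ)).indicator
      (measurableSet_of_isLocalEvent_holds (isLocalEvent_setOf_mem e))
  simp_rw [natCast_card_filter_mem_eq_sum_indicator]
  exact (h.const_mul a).sub (integrable_const c)

open Classical in
/-- The coordinate-edge count, normalised and centred, is integrable. [folklore] -/
theorem integrable_card_filter_coordEdge (Λ : Finset (Site d)) (a c : ℝ) (P : Measure (BondConfig (Site d)))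
    [IsFiniteMeasure P] : Integrable (fun ω => a *
      (#((Λ ×ˢ (Finset.univ : Finset (Fin d))).filter fun xi => s(xi.1, xi.1 + Pi.single xi.2 1) ∈ ω) : ℝ) - c) P := by
  have h : Integrable (fun ω => ∑ x ∈ Λ, ∑ i : Fin d, (BondConfig.relabel (sym2Equiv (Site.shift (-x))) ⁻¹'
      {ω : BondConfig (Site d) | s((0 : Site d), Pi.single i 1) ∈ ω}).indicator (1 : BondConfig (Site d) → ℝ) ω) P :=
    integrable_finsetSum _ fun x _ => integrable_finsetSum _ fun i _ => (integrable_const (1 : ℝ)).indicator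
      ((BondConfig.relabel _).measurable (measurableSet_of_isLocalEvent_holds (isLocalEvent_setOf_mem _)))
  simp_rw [← sum_sum_indicator_eq_card_filter_coordEdge]
  exact (h.const_mul a).sub (integrable_const c)

open Classical in
/-- **Law of large numbers for the open-edge density under `φ^b_{p,q}` (`L¹`)**: for `d ≥ 1`, `0 ≤ p ≤ 1`, `q ≥ 1`, both
`b`, and any lattice edge `e₀`: `∫ | |Λ_n|⁻¹ · |ω ∩ E_{Λ_n}| − d φ^b_{p,q}(e₀ open) | dφ^b_{p,q} → 0` as `n → ∞` (so the
fraction of open edges `|ω ∩ E_{Λ_n}|/|E_{Λ_n}| → h^b(p,q)`, as `|E_{Λ_n}|/|Λ_n| → d`).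
[cite: Grimmett2006, Cor. (4.23) with (4.61), (4.74)–(4.76)] -/
theorem tendsto_integral_abs_openEdges_div_card_box_sub (hd : 0 < d) (b : Bool) (hp : p ∈ Set.Icc (0 : ℝ) 1)
    (hq : 1 ≤ q) {e₀ : Sym2 (Site d)} (he₀ : e₀ ∈ (zdGraph d).edgeSet) :
    Tendsto (fun N : ℕ => ∫ ω, |(#(box d N) : ℝ)⁻¹ * #((edgesIn (zdGraph d) (box d N)).filter fun e => e ∈ ω) -
        d * (rcLimit d b p q).real {ω | e₀ ∈ ω}| ∂(rcLimit d b p q)) atTop (𝓝 0) := by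
  haveI := isProbabilityMeasure_rcLimit (d := d) b p q
  have hc0 : 0 ≤ (d : ℝ) * (rcLimit d b p q).real {ω | e₀ ∈ ω} := mul_nonneg (Nat.cast_nonneg _) measureReal_nonneg
  -- the coordinate-edge averages over `Λ_N` and over `Λ_{N-1}` both converge in `L¹`, and `|Λ_{N-1}|/|Λ_N| → 1`
  have hup := tendsto_integral_abs_card_filter_coordEdge_div_sub b hp hq he₀ (tendsto_natCast_card_box_atTop hd)
  have hlow := (tendsto_integral_abs_card_filter_coordEdge_div_sub b hp hq he₀ (tendsto_natCast_card_box_atTop hd)).comp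
    (tendsto_sub_atTop_nat 1)
  have hr : Tendsto (fun N : ℕ => (1 - (#(box d (N - 1)) : ℝ) / #(box d N)) *
      (d * (rcLimit d b p q).real {ω | e₀ ∈ ω})) atTop (𝓝 0) := by
    have h := ((tendsto_const_nhds (x := (1 : ℝ))).sub (tendsto_card_box_sub_div_card_box (d := d) 1)).mul_const
      (d * (rcLimit d b p q).real {ω | e₀ ∈ ω})
    rwa [sub_self, zero_mul] at h
  have hlim : Tendsto (fun N : ℕ =>
      (∫ ω, |(#(box d N) : ℝ)⁻¹ *
        #((box d N ×ˢ (Finset.univ : Finset (Fin d))).filter fun xi => s(xi.1, xi.1 + Pi.single xi.2 1) ∈ ω) -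
        d * (rcLimit d b p q).real {ω | e₀ ∈ ω}| ∂(rcLimit d b p q)) +
      (∫ ω, |(#(box d (N - 1)) : ℝ)⁻¹ *
        #((box d (N - 1) ×ˢ (Finset.univ : Finset (Fin d))).filter fun xi => s(xi.1, xi.1 + Pi.single xi.2 1) ∈ ω) -
        d * (rcLimit d b p q).real {ω | e₀ ∈ ω}| ∂(rcLimit d b p q)) +
      (1 - (#(box d (N - 1)) : ℝ) / #(box d N)) * (d * (rcLimit d b p q).real {ω | e₀ ∈ ω}))
      atTop (𝓝 (0 + 0 + 0)) := (hup.add hlow).add hr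
  rw [add_zero, add_zero] at hlim
  refine squeeze_zero' (Eventually.of_forall fun N => integral_nonneg fun ω => abs_nonneg _) ?_ hlim
  filter_upwards [eventually_ge_atTop 1] with N hN
  have hpos : (0 : ℝ) < #(box d N) := by exact_mod_cast Finset.card_pos.2 (box_nonempty d N)
  have hpos' : (0 : ℝ) < #(box d (N - 1)) := by exact_mod_cast Finset.card_pos.2 (box_nonempty d (N - 1))
  have hr0 : 0 ≤ (#(box d (N - 1)) : ℝ) / #(box d N) := by positivity
  have hr1 : (#(box d (N - 1)) : ℝ) / #(box d N) ≤ 1 := by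
    rw [div_le_one hpos]; exact_mod_cast Finset.card_le_card (box_mono d (Nat.sub_le N 1))
  -- the pointwise squeeze
  have hpt : ∀ ω : BondConfig (Site d),
      |(#(box d N) : ℝ)⁻¹ * #((edgesIn (zdGraph d) (box d N)).filter fun e => e ∈ ω) -
        d * (rcLimit d b p q).real {ω | e₀ ∈ ω}| ≤
      |(#(box d N) : ℝ)⁻¹ *
        #((box d N ×ˢ (Finset.univ : Finset (Fin d))).filter fun xi => s(xi.1, xi.1 + Pi.single xi.2 1) ∈ ω) -
        d * (rcLimit d b p q).real {ω | e₀ ∈ ω}| +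
      (|(#(box d (N - 1)) : ℝ)⁻¹ *
        #((box d (N - 1) ×ˢ (Finset.univ : Finset (Fin d))).filter fun xi => s(xi.1, xi.1 + Pi.single xi.2 1) ∈ ω) -
        d * (rcLimit d b p q).real {ω | e₀ ∈ ω}| +
      (1 - (#(box d (N - 1)) : ℝ) / #(box d N)) * (d * (rcLimit d b p q).real {ω | e₀ ∈ ω})) := fun ω => by
    have hlo : (#(box d N) : ℝ)⁻¹ *
        #((box d (N - 1) ×ˢ (Finset.univ : Finset (Fin d))).filter fun xi => s(xi.1, xi.1 + Pi.single xi.2 1) ∈ ω) ≤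
        (#(box d N) : ℝ)⁻¹ * #((edgesIn (zdGraph d) (box d N)).filter fun e => e ∈ ω) :=
      mul_le_mul_of_nonneg_left (by exact_mod_cast card_filter_coordEdge_box_pred_le hN ω) (inv_nonneg.2 hpos.le)
    have hhi : (#(box d N) : ℝ)⁻¹ * #((edgesIn (zdGraph d) (box d N)).filter fun e => e ∈ ω) ≤ (#(box d N) : ℝ)⁻¹ *
        #((box d N ×ˢ (Finset.univ : Finset (Fin d))).filter fun xi => s(xi.1, xi.1 + Pi.single xi.2 1) ∈ ω) :=
      mul_le_mul_of_nonneg_left (by exact_mod_cast card_filter_edgesIn_le_card_filter_coordEdge (box d N) ω)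
        (inv_nonneg.2 hpos.le)
    refine (abs_sub_le_abs_add_abs_of_le_of_le hlo hhi).trans (add_le_add le_rfl ?_)
    have hresc : (#(box d N) : ℝ)⁻¹ *
        (#((box d (N - 1) ×ˢ (Finset.univ : Finset (Fin d))).filter fun xi => s(xi.1, xi.1 + Pi.single xi.2 1) ∈ ω) : ℝ)
        = (#(box d (N - 1)) : ℝ) / #(box d N) * ((#(box d (N - 1)) : ℝ)⁻¹ *
          #((box d (N - 1) ×ˢ (Finset.univ : Finset (Fin d))).filter fun xi => s(xi.1, xi.1 + Pi.single xi.2 1) ∈ ω)) := by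
      field_simp
    rw [hresc]
    exact abs_mul_sub_le_of_le_one hr0 hr1 hc0
  have hint1 := (integrable_card_filter_coordEdge (box d N) ((#(box d N) : ℝ)⁻¹)
    (d * (rcLimit d b p q).real {ω | e₀ ∈ ω}) (rcLimit d b p q)).abs
  have hint2 := (integrable_card_filter_coordEdge (box d (N - 1)) ((#(box d (N - 1)) : ℝ)⁻¹)
    (d * (rcLimit d b p q).real {ω | e₀ ∈ ω}) (rcLimit d b p q)).abs
  calc ∫ ω, |(#(box d N) : ℝ)⁻¹ * #((edgesIn (zdGraph d) (box d N)).filter fun e => e ∈ ω) -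
        d * (rcLimit d b p q).real {ω | e₀ ∈ ω}| ∂(rcLimit d b p q)
      ≤ ∫ ω, (|(#(box d N) : ℝ)⁻¹ *
        #((box d N ×ˢ (Finset.univ : Finset (Fin d))).filter fun xi => s(xi.1, xi.1 + Pi.single xi.2 1) ∈ ω) -
        d * (rcLimit d b p q).real {ω | e₀ ∈ ω}| +
      (|(#(box d (N - 1)) : ℝ)⁻¹ *
        #((box d (N - 1) ×ˢ (Finset.univ : Finset (Fin d))).filter fun xi => s(xi.1, xi.1 + Pi.single xi.2 1) ∈ ω) -
        d * (rcLimit d b p q).real {ω | e₀ ∈ ω}| +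
      (1 - (#(box d (N - 1)) : ℝ) / #(box d N)) * (d * (rcLimit d b p q).real {ω | e₀ ∈ ω}))) ∂(rcLimit d b p q) :=
        integral_mono_of_nonneg (Eventually.of_forall fun ω => abs_nonneg _)
          (hint1.add (hint2.add (integrable_const _))) (Eventually.of_forall hpt)
    _ = _ := by
        have h2c : Integrable (fun ω => |(#(box d (N - 1)) : ℝ)⁻¹ *
            #((box d (N - 1) ×ˢ (Finset.univ : Finset (Fin d))).filter fun xi => s(xi.1, xi.1 + Pi.single xi.2 1) ∈ ω) -
            d * (rcLimit d b p q).real {ω | e₀ ∈ ω}| +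
            (1 - (#(box d (N - 1)) : ℝ) / #(box d N)) * (d * (rcLimit d b p q).real {ω | e₀ ∈ ω})) (rcLimit d b p q) :=
          hint2.add (integrable_const _)
        rw [integral_add hint1 h2c, integral_add hint2 (integrable_const _), integral_const,
          smul_eq_mul, probReal_univ, one_mul, add_assoc]

open Classical in
/-- **Law of large numbers for the open-edge density under `φ^b_{p,q}` (in probability)**: for every `δ > 0`,
`φ^b_{p,q}(| |Λ_n|⁻¹ |ω ∩ E_{Λ_n}| − d φ^b_{p,q}(e₀ open) | ≥ δ) → 0` (`d ≥ 1`).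
[cite: Grimmett2006, Cor. (4.23) with (4.61), (4.74)–(4.76)] -/
theorem tendsto_rcLimit_real_le_abs_openEdges_div_card_box_sub (hd : 0 < d) (b : Bool) (hp : p ∈ Set.Icc (0 : ℝ) 1)
    (hq : 1 ≤ q) {e₀ : Sym2 (Site d)} (he₀ : e₀ ∈ (zdGraph d).edgeSet) {δ : ℝ} (hδ : 0 < δ) :
    Tendsto (fun N : ℕ => (rcLimit d b p q).real {ω | δ ≤ |(#(box d N) : ℝ)⁻¹ *
        #((edgesIn (zdGraph d) (box d N)).filter fun e => e ∈ ω) - d * (rcLimit d b p q).real {ω | e₀ ∈ ω}|})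
      atTop (𝓝 0) := by
  haveI := isProbabilityMeasure_rcLimit (d := d) b p q
  exact tendsto_measureReal_le_abs_of_integral (fun N => integrable_card_filter_mem _ _ _ _)
    (tendsto_integral_abs_openEdges_div_card_box_sub hd b hp hq he₀) hδ

end Summit.CriticalPhenomena.PercolationContinuityZ3.Theorems.FK

end
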